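import Literature.Barriers.Parity.SiegelZeroDichotomyPairHLMainTermLocal
import Literature.Barriers.Parity.SiegelZeroDichotomyPairHLSixSlotEuler
import Literature.Barriers.Parity.SiegelZeroDichotomyChowla
import Literature.NumberTheory.LFunctions.MertensElementary
import HarnessLib

/-!
# Tao–Teräväinen 2022, §8 (`k = 2`): the crude bound for the Euler product of the kernel (`KB1`)

Topic `Literature/Barriers/Parity`, sub-namespace `TaoTeravainen`; the first of the three kernel bounds of
the §8 assembly (`SiegelZeroDichotomyPairHLProp81Kernel.lean`), in the proof DAG of
`Literature.Barriers.Parity.TaoTeravainen2021_prop72_81_pair` (T. Tao, J. Teräväinen, *The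
Hardy–Littlewood–Chowla conjecture in the presence of a Siegel zero*, J. London Math. Soc. (2) 106 (2022),
arXiv:2109.06291), §8 after (8.19): "From the triangle inequality one has the crude bound
`E_p = 1 + O(1/p^{1+1/log R})` and thus by Mertens' theorem `∏_p E_p ≪ log^{O(1)} R`." We prove the
(weaker in the exponent, uniform in all Fourier variables) form that the assembly consumes:

* `norm_localE_le_crude` — `‖E_p‖ ≤ 972` for every `p ≥ 2` (all `v_H`, `L`);
* `norm_prod_localE_le` — for side data of norm `≤ 1` and `L ≥ 1`,
  `‖∏_{p<N} E_p‖ ≤ 972^{ω(Δ)} · exp(26 (log log N + 4))`, `Δ = |h₁ − h₂| ≠ 0`, `N ≥ 2`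
  (`MainTerm.norm_localE_sub_one_le` for `p ∤ Δ`, Mertens `∑_{p≤N} 1/p ≤ log log N + 4`);
* **`kernel_KB1`** — the bound for the kernel of `…SixSlotEuler.lean` in the main term's variables;
* `assemblyKernel` — the kernel at the data of the final assembly (`X = log x`, `R = pairScaleR η x`, `N = x+1`).
  [cite: TaoTeravainen2021, §8 (the crude bound after (8.19))]
-/

noncomputable section

open Finset Real Complex

namespace Literature.Barriers.Parity

namespace TaoTeravainen

open Literature.NumberTheory.LFunctions.MertensBound (sum_inv_prime_le)

variable {q : ℕ}

/-- **`‖E_p‖ ≤ 972`** for `p ≥ 2`, any `v_H, L`, side data of norm `≤ 1` and `|χ(p)| ≤ 1`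
(`‖c_{p^A}‖ ≤ 9`, `∑_{A,B} p^{-max(A,B)} ≤ 12`). [folklore] -/
theorem norm_localE_le_crude {p : ℕ} (hp : 2 ≤ p) (vH L : ℕ) {χp : ℝ} (hχ : |χp| ≤ 1) {u v₁ v₂ : Fin 2 → ℂ}
    (hu : ∀ j, ‖u j‖ ≤ 1) (hv₁ : ∀ j, ‖v₁ j‖ ≤ 1) (hv₂ : ∀ j, ‖v₂ j‖ ≤ 1) :
    ‖MainTerm.localE p vH L χp u v₁ v₂‖ ≤ 972 := by
  unfold MainTerm.localE
  have hterm : ∀ A B : ℕ, ‖(if min A B ≤ vH then ((p : ℂ) ^ max A B)⁻¹ *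
      (MainTerm.slotC χp (u 0) (v₁ 0) (v₂ 0) A * MainTerm.slotC χp (u 1) (v₁ 1) (v₂ 1) B) else 0)‖ ≤
      ((p : ℝ) ^ max A B)⁻¹ * 81 := by
    intro A B
    split_ifs
    · rw [norm_mul, norm_inv, norm_pow, Complex.norm_natCast, norm_mul]
      gcongr
      calc ‖MainTerm.slotC χp (u 0) (v₁ 0) (v₂ 0) A‖ * ‖MainTerm.slotC χp (u 1) (v₁ 1) (v₂ 1) B‖ ≤ 9 * 9 :=
            mul_le_mul (MainTerm.norm_slotC_le hχ (hu 0) (hv₁ 0) (hv₂ 0) A)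
              (MainTerm.norm_slotC_le hχ (hu 1) (hv₁ 1) (hv₂ 1) B) (norm_nonneg _) (by norm_num)
        _ = 81 := by norm_num
    · rw [norm_zero]; positivity
  calc _ ≤ ∑ A ∈ range (L + 1), ‖∑ B ∈ range (L + 1), (if min A B ≤ vH then ((p : ℂ) ^ max A B)⁻¹ *
          (MainTerm.slotC χp (u 0) (v₁ 0) (v₂ 0) A * MainTerm.slotC χp (u 1) (v₁ 1) (v₂ 1) B) else 0)‖ :=
        norm_sum_le _ _
    _ ≤ ∑ A ∈ range (L + 1), ∑ B ∈ range (L + 1), ((p : ℝ) ^ max A B)⁻¹ * 81 :=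
        sum_le_sum fun A _ => (norm_sum_le _ _).trans (sum_le_sum fun B _ => hterm A B)
    _ = (∑ A ∈ range (L + 1), ∑ B ∈ range (L + 1), ((p : ℝ) ^ max A B)⁻¹) * 81 := by
        rw [sum_mul]; refine sum_congr rfl fun A _ => ?_; rw [sum_mul]
    _ ≤ 12 * 81 := mul_le_mul_of_nonneg_right (MainTerm.sum_sum_inv_pow_max_le hp L) (by norm_num)
    _ = 972 := by norm_num

/-- **The crude bound for the product** (`KB1` in abstract variables): for `Δ ≠ 0`, `L ≥ 1`, `N ≥ 2`,
`|χ(p)| ≤ 1` and side data of norm `≤ 1`,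
`‖∏_{p<N} E_p‖ ≤ 972^{ω(Δ)} exp(26 (log log N + 4))`. [cite: TaoTeravainen2021, §8 (after (8.19))] -/
theorem norm_prod_localE_le {Δ : ℕ} (hΔ : Δ ≠ 0) {L : ℕ} (hL : 1 ≤ L) {N : ℕ} (hN : 2 ≤ N)
    (χp : ℕ → ℝ) (hχ : ∀ p, |χp p| ≤ 1) (u v₁ v₂ : ℕ → Fin 2 → ℂ)
    (hu : ∀ p j, ‖u p j‖ ≤ 1) (hv₁ : ∀ p j, ‖v₁ p j‖ ≤ 1) (hv₂ : ∀ p j, ‖v₂ p j‖ ≤ 1) :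
    ‖∏ p ∈ Nat.primesBelow N, MainTerm.localE p (Δ.factorization p) L (χp p) (u p) (v₁ p) (v₂ p)‖ ≤
      972 ^ Δ.primeFactors.card * Real.exp (26 * (Real.log (Real.log N) + 4)) := by
  set P := Nat.primesBelow N with hP
  have hPp : ∀ p ∈ P, p.Prime := fun p hp => Nat.prime_of_mem_primesBelow hp
  rw [← prod_filter_mul_prod_filter_not P (fun p => p ∣ Δ), norm_mul]
  refine mul_le_mul ?_ ?_ (norm_nonneg _) (by positivity)
  · -- primes dividing `Δ`: at most `ω(Δ)` factors, each `≤ 972`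
    rw [norm_prod]
    have hsub : P.filter (fun p => p ∣ Δ) ⊆ Δ.primeFactors := by
      intro p hp
      rw [mem_filter] at hp
      exact Nat.mem_primeFactors.mpr ⟨hPp p hp.1, hp.2, hΔ⟩
    calc ∏ p ∈ P.filter (fun p => p ∣ Δ), ‖MainTerm.localE p (Δ.factorization p) L (χp p) (u p) (v₁ p) (v₂ p)‖
        ≤ ∏ p ∈ P.filter (fun p => p ∣ Δ), (972 : ℝ) :=
          prod_le_prod (fun p _ => norm_nonneg _) fun p hp =>
            norm_localE_le_crude (hPp p (mem_filter.mp hp).1).two_le _ _ (hχ p) (hu p) (hv₁ p) (hv₂ p)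
      _ = 972 ^ (P.filter (fun p => p ∣ Δ)).card := prod_const _
      _ ≤ 972 ^ Δ.primeFactors.card := pow_le_pow_right₀ (by norm_num) (card_le_card hsub)
  · -- primes not dividing `Δ`: `‖E_p‖ ≤ 1 + 26/p ≤ exp(26/p)`
    rw [norm_prod]
    have hfac : ∀ p ∈ P.filter (fun p => ¬p ∣ Δ),
        ‖MainTerm.localE p (Δ.factorization p) L (χp p) (u p) (v₁ p) (v₂ p)‖ ≤ Real.exp (26 / (p : ℝ)) := by
      intro p hp
      rw [mem_filter] at hp
      have hpr := hPp p hp.1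
      rw [Nat.factorization_eq_zero_of_not_dvd hp.2]
      have h := MainTerm.norm_localE_sub_one_le hpr.two_le hL (hχ p) (hu p) (hv₁ p) (hv₂ p)
      have h1 : ‖MainTerm.localE p 0 L (χp p) (u p) (v₁ p) (v₂ p)‖ ≤ 26 / p + 1 := by
        calc ‖MainTerm.localE p 0 L (χp p) (u p) (v₁ p) (v₂ p)‖
            = ‖(MainTerm.localE p 0 L (χp p) (u p) (v₁ p) (v₂ p) - 1) + 1‖ := by rw [sub_add_cancel]
          _ ≤ ‖MainTerm.localE p 0 L (χp p) (u p) (v₁ p) (v₂ p) - 1‖ + ‖(1 : ℂ)‖ := norm_add_le _ _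
          _ ≤ 26 / p + 1 := by rw [norm_one]; linarith
      have h2 := Real.add_one_le_exp (26 / (p : ℝ))
      linarith
    calc ∏ p ∈ P.filter (fun p => ¬p ∣ Δ), ‖MainTerm.localE p (Δ.factorization p) L (χp p) (u p) (v₁ p) (v₂ p)‖
        ≤ ∏ p ∈ P.filter (fun p => ¬p ∣ Δ), Real.exp (26 / (p : ℝ)) :=
          prod_le_prod (fun p _ => norm_nonneg _) hfac
      _ = Real.exp (26 * ∑ p ∈ P.filter (fun p => ¬p ∣ Δ), 1 / (p : ℝ)) := by
          rw [mul_sum, Real.exp_sum]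
          refine prod_congr rfl fun p _ => ?_
          rw [mul_one_div]
      _ ≤ Real.exp (26 * (Real.log (Real.log N) + 4)) := by
          refine Real.exp_le_exp.mpr (mul_le_mul_of_nonneg_left ?_ (by norm_num))
          calc ∑ p ∈ P.filter (fun p => ¬p ∣ Δ), 1 / (p : ℝ) ≤ ∑ p ∈ Nat.primesLE N, 1 / (p : ℝ) := by
                refine sum_le_sum_of_subset_of_nonneg (fun p hp => ?_) fun p _ _ => by positivity
                rw [mem_filter, hP, Nat.mem_primesBelow] at hp
                exact Nat.mem_primesLE.mpr ⟨hp.1.1.le, hp.1.2⟩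
            _ ≤ Real.log (Real.log N) + 4 := sum_inv_prime_le N hN

/-- **`KB1` for the kernel** (`h₁ ≠ h₂`, `A ≥ 1`, `N ≥ 2`, `X > 0`, `R > 1`):
`‖∏_{p<N} E_p(τ)‖ ≤ 972^{ω(|h₁−h₂|)} exp(26 (log log N + 4))` for every `τ`.
[cite: TaoTeravainen2021, §8 (after (8.19))] -/
theorem kernel_KB1 (χ : DirichletCharacter ℂ q) {X R : ℝ} (hX : 0 < X) (hR : 1 < R) {h₁ h₂ : ℕ} (hne : h₁ ≠ h₂)
    {A : ℕ} (hA : 1 ≤ A) {N : ℕ} (hN : 2 ≤ N) (τ : Slot → ℝ) :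
    ‖∏ p ∈ Nat.primesBelow N, MainTerm.localE p ((shiftDiff h₁ h₂).factorization p) A (realChar χ p)
        (fun j => npow (slotExpo X R (j, 0) (τ (j, 0))) p)
        (fun j => npow (slotExpo X R (j, 1) (τ (j, 1))) p)
        (fun j => npow (slotExpo X R (j, 2) (τ (j, 2))) p)‖ ≤
      972 ^ (shiftDiff h₁ h₂).primeFactors.card * Real.exp (26 * (Real.log (Real.log N) + 4)) := by
  have hΔ : shiftDiff h₁ h₂ ≠ 0 := shiftDiff_ne_zero hne
  -- norms of the side data
  have hre : ∀ k : Slot, ∀ t : ℝ, (slotExpo X R k t).re ≤ 0 := by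
    intro k t
    unfold slotExpo
    split_ifs
    · simp only [Complex.add_re, Complex.neg_re, Complex.ofReal_re, Complex.mul_re, Complex.re_ofNat,
        Complex.ofReal_im, Complex.im_ofNat, Complex.I_re, Complex.I_im, Complex.mul_im]
      have : 0 < X⁻¹ := by positivity
      nlinarith
    · have hlogR : 0 < Real.log R := Real.log_pos hR
      rw [Complex.div_ofReal_re]
      refine div_nonpos_of_nonpos_of_nonneg ?_ hlogR.le
      simp
  have hnorm : ∀ (k : Slot) (t : ℝ) (p : ℕ), p ∈ Nat.primesBelow N → ‖npow (slotExpo X R k t) p‖ ≤ 1 :=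
    fun k t p hp => norm_npow_le_one (hre k t) (Nat.prime_of_mem_primesBelow hp).one_le
  classical
  have h := norm_prod_localE_le hΔ hA hN (fun p => realChar χ p) (fun p => abs_realChar_le_one χ p)
    (fun p j => if p ∈ Nat.primesBelow N then npow (slotExpo X R (j, 0) (τ (j, 0))) p else 1)
    (fun p j => if p ∈ Nat.primesBelow N then npow (slotExpo X R (j, 1) (τ (j, 1))) p else 1)
    (fun p j => if p ∈ Nat.primesBelow N then npow (slotExpo X R (j, 2) (τ (j, 2))) p else 1)
    (fun p j => by by_cases hp : p ∈ Nat.primesBelow N <;> simp only [hp, if_true, if_false, norm_one, le_refl]; exact hnorm _ _ p hp)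
    (fun p j => by by_cases hp : p ∈ Nat.primesBelow N <;> simp only [hp, if_true, if_false, norm_one, le_refl]; exact hnorm _ _ p hp)
    (fun p j => by by_cases hp : p ∈ Nat.primesBelow N <;> simp only [hp, if_true, if_false, norm_one, le_refl]; exact hnorm _ _ p hp)
  refine le_trans (le_of_eq ?_) h
  congr 1
  refine prod_congr rfl fun p hp => ?_
  simp only [hp, if_true]

/-- The kernel of the main term at the data of the final assembly: `K(τ) = ∏_{p ≤ x} E_p(τ)` with
`X = log x`, `R = pairScaleR η x`, `N = x + 1`, truncation `A`. [cite: TaoTeravainen2021, §8 (8.17)–(8.19)] -/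
def assemblyKernel (χ : DirichletCharacter ℂ q) (h₁ h₂ : ℕ) (η : ℝ) (x A : ℕ) (τ : Slot → ℝ) : ℂ :=
  ∏ p ∈ Nat.primesBelow (x + 1), MainTerm.localE p ((shiftDiff h₁ h₂).factorization p) A (realChar χ p)
    (fun j => npow (slotExpo (Real.log x) (pairScaleR η x) (j, 0) (τ (j, 0))) p)
    (fun j => npow (slotExpo (Real.log x) (pairScaleR η x) (j, 1) (τ (j, 1))) p)
    (fun j => npow (slotExpo (Real.log x) (pairScaleR η x) (j, 2) (τ (j, 2))) p)

end TaoTeravainen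

end Literature.Barriers.Parity
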